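import Literature.Analysis.FluidPDE.CriticalSpacesProofs
import Literature.Analysis.FunctionSpaces.LittlewoodPaleyBernsteinProofs
import Literature.Analysis.FunctionSpaces.LittlewoodPaleyProofs
import Literature.Analysis.FunctionSpaces.BMOBesovProofs
import HarnessLib

/-!
# `L^p ⊂ 𝓢'_h` for `p < ∞`: `L^p` functions have vanishing low frequencies

Analysis/FluidPDE proof file (no definitions, no named facts). It proves the realisation
condition of the homogeneous Besov classes (`Literature.Analysis.FunctionSpaces.MemHomBesov`:
`Ṡ_j u → 0` in `𝓢'` as `j → -∞`) for (the tempered distributions of) `L^p` functions with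
`p < ∞`:

* `tendsto_lowFreqCutoff_coe_Lp_atBot`: for `f ∈ L^p(E; F)`, `1 ≤ p < ∞`, `dim E ≥ 1`,
  `Ṡ_j ↑f → 0` in `𝓢'(E, F)` as `j → -∞`;
* `tendsto_lowFreqCutoff_of_memLp_of_isDistributionOf`: the same for a real vector field
  `f ∈ L^p(E; ℝ^ι)` read through its tempered distribution `W` (`IsDistributionOf f W`).

This is Bahouri–Chemin–Danchin 2011, Def. 1.26 (`u ∈ 𝓢'_h` iff `‖θ(λD)u‖_{L^∞} → 0` as
`λ → ∞`) with the Examples following it, by Bernstein's inequality (Lemma 2.1):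
`‖Ṡ_j f‖_{L^∞} ≤ C 2^{jd/p} ‖f‖_{L^p} → 0` when `p < ∞`. The tree had the case `p = 2`, `E = ℝ³`
(`tendsto_lowFreqCutoff_of_memLp_two_holds`, by Plancherel); the proof here is the same with
Hölder in place of Cauchy–Schwarz: `⟨Ṡ_j f, u⟩ = ∫ u • ((𝓕⁻¹χ(2^{-j}·)) ⋆ f)`
(`fourierMultiplierCLM_coe_apply_eq_integral_convolution`),
`‖(𝓕⁻¹χ(2^{-j}·)) ⋆ f‖_∞ ≤ ‖𝓕⁻¹χ(2^{-j}·)‖_{L^{p'}} ‖f‖_{L^p}`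
(`enorm_convolution_smul_le_eLpNorm_mul`) and, by the scaling
`𝓕⁻¹χ(2^{-j}·) = 2^{jd} (𝓕⁻¹χ)(2^j ·)` (`fourierInv_comp_smul`, `eLpNorm_comp_smul`),
`‖𝓕⁻¹χ(2^{-j}·)‖_{L^{p'}} = 2^{jd(1-1/p')} ‖𝓕⁻¹χ‖_{L^{p'}} = 2^{jd/p} ‖𝓕⁻¹χ‖_{L^{p'}} → 0`.
It serves the decomposition of `exists_isBesovMildSolutionOn` (Besov regularity of the Duhamel
term of a Kato-class mild solution, which is an `L^p` function). False for `p = ∞` (constants)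
and in dimension `0`.

## References

* H. Bahouri, J.-Y. Chemin, R. Danchin, *Fourier Analysis and Nonlinear PDE*, Grundlehren 343
  (2011), Def. 1.26 and Examples; Lemma 2.1. [BahouriCheminDanchin2011]
-/

noncomputable section

open MeasureTheory Set Function Filter FourierTransform
open _root_.Topology
open scoped SchwartzMap ENNReal NNReal Convolution

namespace Literature.Analysis.FluidPDE

section General

variable {E F : Type*} [NormedAddCommGroup E] [InnerProductSpace ℝ E] [FiniteDimensional ℝ E]
  [MeasurableSpace E] [BorelSpace E] [NormedAddCommGroup F] [NormedSpace ℂ F] [CompleteSpace F]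

omit [FiniteDimensional ℝ E] [MeasurableSpace E] [BorelSpace E] in
/-- The low-frequency symbols are dilates of `χ = χ(2^0 ·)`: `χ(2^{-j}ξ) = χ_0(2^{-j}ξ)`.
[folklore] -/
theorem lowFreqSymbol_eq_zero_comp_smul (j : ℤ) (ξ : E) :
    FunctionSpaces.lowFreqSymbol j ξ = FunctionSpaces.lowFreqSymbol 0 (((2 : ℝ) ^ (-j)) • ξ) := by
  simp [FunctionSpaces.lowFreqSymbol]

/-- `x · (x⁻¹)^θ = x^{1-θ}` for `x > 0`. [folklore] -/
theorem mul_inv_rpow_eq_rpow_one_sub {x : ℝ} (hx : 0 < x) (θ : ℝ) :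
    x * x⁻¹ ^ θ = x ^ (1 - θ) := by
  rw [Real.inv_rpow hx.le, ← Real.rpow_neg hx.le, sub_eq_add_neg, Real.rpow_add hx,
    Real.rpow_one]

/-- **`L^p ⊂ 𝓢'_h` for `p < ∞`** (Bahouri–Chemin–Danchin 2011, Def. 1.26 and the Examples after
it; Bernstein, Lemma 2.1): for `f ∈ L^p(E; F)`, `1 ≤ p < ∞`, `dim E ≥ 1`, the low-frequency
cut-offs `Ṡ_j ↑f = χ(2^{-j}D) ↑f` tend to `0` in `𝓢'(E, F)` as `j → -∞`. Indeed
`⟨Ṡ_j f, u⟩ = ∫ u • (K_j ⋆ f)` with `K_j = 𝓕⁻¹χ(2^{-j}·) = 2^{jd}K_0(2^j ·)`, and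
`|⟨Ṡ_j f, u⟩| ≤ ‖K_j‖_{p'} ‖f‖_p ‖u‖₁ = 2^{jd/p} ‖K_0‖_{p'} ‖f‖_p ‖u‖₁ → 0`.
[cite: BahouriCheminDanchin2011, Def. 1.26 (Examples) and Lemma 2.1] -/
theorem tendsto_lowFreqCutoff_coe_Lp_atBot [Nontrivial E] {p : ℝ≥0∞} [hp1 : Fact (1 ≤ p)]
    (hp : p < ∞) (f : Lp F p (volume : Measure E)) :
    Tendsto (fun j : ℤ => FunctionSpaces.lowFreqCutoff j (f : 𝓢'(E, F))) atBot (𝓝 0) := by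
  -- the conjugate exponent `q = p'`, `1 < q ≤ ∞`
  set q : ℝ≥0∞ := ENNReal.conjExponent p with hqdef
  haveI hpq : p.HolderConjugate q := .conjExponent hp1.out
  haveI hqp : q.HolderConjugate p := inferInstance
  set θ : ℝ := (1 / q).toReal with hθdef
  have hθ1 : θ < 1 := by
    have hq1 : 1 < q := by
      rw [hqdef, ENNReal.conjExponent]
      have : (0 : ℝ≥0∞) < (p - 1)⁻¹ := ENNReal.inv_pos.2 (ENNReal.sub_ne_top hp.ne)
      calc (1 : ℝ≥0∞) = 1 + 0 := (add_zero _).symm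
        _ < 1 + (p - 1)⁻¹ := ENNReal.add_lt_add_left ENNReal.one_ne_top this
    have h1 : 1 / q < 1 := by rw [one_div]; exact ENNReal.inv_lt_one.2 hq1
    have h2 : (1 / q).toReal < (1 : ℝ≥0∞).toReal :=
      (ENNReal.toReal_lt_toReal (ne_top_of_lt h1) ENNReal.one_ne_top).2 h1
    simpa [hθdef] using h2
  set d : ℕ := Module.finrank ℝ E with hd
  have hdpos : 0 < d := Module.finrank_pos
  rw [PointwiseConvergenceCLM.tendsto_iff_forall_tendsto]
  intro u
  -- the symbols as Schwartz functions, the kernels `K_j = 𝓕⁻¹ Ψ_j`, and `h_j = K_j ⋆ f`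
  set Ψ : ℤ → 𝓢(E, ℂ) := fun j =>
    (FunctionSpaces.hasCompactSupport_lowFreqSymbol j).toSchwartzMap
      (FunctionSpaces.contDiff_lowFreqSymbol j) with hΨdef
  have hΨ : ∀ j, ((Ψ j : 𝓢(E, ℂ)) : E → ℂ) = FunctionSpaces.lowFreqSymbol j := fun j => rfl
  set K : ℤ → 𝓢(E, ℂ) := fun j => 𝓕⁻ (Ψ j) with hKdef
  set h : ℤ → E → F := fun j =>
    ((K j : 𝓢(E, ℂ)) : E → ℂ) ⋆[ContinuousLinearMap.lsmul ℂ ℂ, volume] (f : E → F) with hhdef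
  -- the convolution representation of `Ṡ_j f`
  have hrep : ∀ j : ℤ, FunctionSpaces.lowFreqCutoff j (f : 𝓢'(E, F)) u = ∫ y, u y • h j y :=
    fun j => by
    rw [FunctionSpaces.lowFreqCutoff_apply, ← hΨ j]
    exact FunctionSpaces.fourierMultiplierCLM_coe_apply_eq_integral_convolution (Ψ j) f u
  -- scaling of the kernels: `K_j = X_j • K_0(2^j ·)`, `X_j = 2^{jd}`
  set X : ℤ → ℝ := fun j => ((2 : ℝ) ^ j) ^ d with hXdef
  have hXpos : ∀ j, 0 < X j := fun j => by positivity
  have hKfun : ∀ j : ℤ, ((K j : 𝓢(E, ℂ)) : E → ℂ) =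
      X j • fun w => ((K 0 : 𝓢(E, ℂ)) : E → ℂ) (((2 : ℝ) ^ j) • w) := by
    intro j
    have h2 : (2 : ℝ) ^ (-j) ≠ 0 := zpow_ne_zero _ two_ne_zero
    funext w
    rw [hKdef]
    simp only [SchwartzMap.fourierInv_coe, Pi.smul_apply]
    rw [hΨ j, hΨ 0, show (FunctionSpaces.lowFreqSymbol j : E → ℂ) =
        fun v => FunctionSpaces.lowFreqSymbol 0 (((2 : ℝ) ^ (-j)) • v) from
          funext (lowFreqSymbol_eq_zero_comp_smul j),
      Literature.Analysis.FunctionSpaces.fourierInv_comp_smul _ h2]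
    congr 1
    · rw [hXdef, zpow_neg, inv_pow, inv_inv, abs_of_pos (by positivity)]
    · rw [zpow_neg, inv_inv]
  have hKnorm : ∀ j : ℤ, eLpNorm ((K j : 𝓢(E, ℂ)) : E → ℂ) q volume =
      ENNReal.ofReal (X j * (X j)⁻¹ ^ θ) * eLpNorm ((K 0 : 𝓢(E, ℂ)) : E → ℂ) q volume := by
    intro j
    have h2 : (2 : ℝ) ^ j ≠ 0 := zpow_ne_zero _ two_ne_zero
    rw [hKfun j, eLpNorm_const_smul, Real.enorm_eq_ofReal (hXpos j).le,
      Literature.Analysis.FunctionSpaces.eLpNorm_comp_smul q _ h2, ← mul_assoc,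
      ENNReal.ofReal_mul (hXpos j).le]
    show ENNReal.ofReal (X j) * ENNReal.ofReal |(X j)⁻¹| ^ (1 / q).toReal * _ = _
    rw [abs_of_pos (inv_pos.2 (hXpos j)), ENNReal.ofReal_rpow_of_pos (inv_pos.2 (hXpos j))]
  -- the bound `‖h_j(y)‖ ≤ X_j^{1-θ} ‖K_0‖_{p'} ‖f‖_p =: M_j`
  set A : ℝ≥0∞ := eLpNorm ((K 0 : 𝓢(E, ℂ)) : E → ℂ) q volume * eLpNorm f p volume with hA
  have hAtop : A ≠ ∞ :=
    ENNReal.mul_ne_top ((K 0).memLp q volume).eLpNorm_ne_top (Lp.memLp f).eLpNorm_ne_top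
  set M : ℤ → ℝ := fun j => (X j) ^ (1 - θ) * A.toReal with hMdef
  have hbound : ∀ (j : ℤ) (y : E), ‖h j y‖ ≤ M j := by
    intro j y
    have h1 : ‖h j y‖ₑ ≤ eLpNorm ((K j : 𝓢(E, ℂ)) : E → ℂ) q volume * eLpNorm (f : E → F) p volume :=
      FunctionSpaces.enorm_convolution_smul_le_eLpNorm_mul (K j).continuous.aestronglyMeasurable
        (Lp.aestronglyMeasurable f) p q y
    rw [hKnorm j, mul_assoc, mul_inv_rpow_eq_rpow_one_sub (hXpos j)] at h1
    have htop : ENNReal.ofReal (X j ^ (1 - θ)) * A ≠ ∞ := ENNReal.mul_ne_top ENNReal.ofReal_ne_top hAtop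
    calc ‖h j y‖ = (‖h j y‖ₑ).toReal := (toReal_enorm _).symm
      _ ≤ (ENNReal.ofReal (X j ^ (1 - θ)) * A).toReal := ENNReal.toReal_mono htop h1
      _ = M j := by
          rw [hMdef, ENNReal.toReal_mul, ENNReal.toReal_ofReal (Real.rpow_nonneg (hXpos j).le _)]
  -- `|⟨Ṡ_j f, u⟩| ≤ M_j ‖u‖_{L¹}`
  have hest : ∀ j : ℤ, ‖FunctionSpaces.lowFreqCutoff j (f : 𝓢'(E, F)) u‖ ≤ M j * ∫ y, ‖u y‖ := by
    intro j
    rw [hrep j]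
    calc ‖∫ y, u y • h j y‖ ≤ ∫ y, ‖u y • h j y‖ := norm_integral_le_integral_norm _
      _ ≤ ∫ y, ‖u y‖ * M j := by
          refine integral_mono_of_nonneg (Eventually.of_forall fun y => norm_nonneg _)
            (u.integrable.norm.mul_const _) (Eventually.of_forall fun y => ?_)
          show ‖u y • h j y‖ ≤ ‖u y‖ * M j
          rw [norm_smul]
          exact mul_le_mul_of_nonneg_left (hbound j y) (norm_nonneg _)
      _ = M j * ∫ y, ‖u y‖ := by rw [integral_mul_const, mul_comm]
  -- `M_j → 0` as `j → -∞` (`dim E ≥ 1`, `1 - θ > 0`)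
  have hM : Tendsto M atBot (𝓝 0) := by
    have h1 : Tendsto X atBot (𝓝 0) := by
      have := Literature.Analysis.FunctionSpaces.tendsto_two_zpow_atBot.pow d
      simpa [hXdef, zero_pow hdpos.ne'] using this
    have h2 : Tendsto (fun j : ℤ => X j ^ (1 - θ)) atBot (𝓝 0) := by
      have := ((Real.continuous_rpow_const (by linarith : (0 : ℝ) ≤ 1 - θ)).tendsto 0).comp h1
      simpa [Function.comp_def, Real.zero_rpow (by linarith : (1 - θ : ℝ) ≠ 0)] using this
    simpa [hMdef] using h2.mul_const A.toReal
  have hlim : Tendsto (fun j => M j * ∫ y, ‖u y‖) atBot (𝓝 0) := by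
    simpa using hM.mul_const (∫ y, ‖u y‖)
  simpa using squeeze_zero_norm hest hlim

end General

section Fields

variable {ι : Type*} [Fintype ι] {E : Type*} [NormedAddCommGroup E] [InnerProductSpace ℝ E]
  [FiniteDimensional ℝ E] [MeasurableSpace E] [BorelSpace E]

/-- **The distribution of an `L^p` vector field, `p < ∞`, has vanishing low frequencies**
(Bahouri–Chemin–Danchin 2011, Def. 1.26 with the Examples, Lemma 2.1): for `f ∈ L^p(E; ℝ^ι)`,
`1 ≤ p < ∞`, `dim E ≥ 1`, with tempered distribution `W` (`IsDistributionOf f W`, i.e. Mathlib's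
distribution of the class of `complexify ∘ f`), `Ṡ_j W → 0` in `𝓢'` as `j → -∞` — the
realisation condition of `Literature.Analysis.FunctionSpaces.MemHomBesov`. The case `p = 2`,
`E = ℝ³` is the tree's `tendsto_lowFreqCutoff_of_memLp_two_holds`.
[cite: BahouriCheminDanchin2011, Def. 1.26 (Examples) and Lemma 2.1] -/
theorem tendsto_lowFreqCutoff_of_memLp_of_isDistributionOf [Nontrivial E] {p : ℝ≥0∞}
    [Fact (1 ≤ p)] (hp : p < ∞) {f : E → EuclideanSpace ℝ ι} {W : 𝓢'(E, EuclideanSpace ℂ ι)}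
    (hf : MemLp f p volume) (hW : IsDistributionOf f W) :
    Tendsto (fun j : ℤ => FunctionSpaces.lowFreqCutoff j W) atBot (𝓝 0) := by
  rw [hW.unique (isDistributionOf_toTemperedDistribution hf)]
  exact tendsto_lowFreqCutoff_coe_Lp_atBot hp _

end Fields

end Literature.Analysis.FluidPDE
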